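import Mathlib.Algebra.MonoidAlgebra.Basic
import Mathlib.Algebra.CharP.Lemmas
import Mathlib.Algebra.CharP.Algebra
import Mathlib.GroupTheory.Commutator.Basic
import Mathlib.LinearAlgebra.Span.Basic
import Mathlib.Algebra.Algebra.Operations
import Mathlib.Algebra.BigOperators.Intervals
import Mathlib.Data.List.FinRange
import Mathlib.Data.Finset.Sort
import Mathlib.Tactic.NoncommRing
import Mathlib.Tactic.Group
import Mathlib.SetTheory.Cardinal.Finite
import HarnessLib

/-!
# Words in a `p`-central generating system, I: rewriting rules and nilpotency (towards Jennings' theorem, BCCGU 2017 §3.1.1)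

Topic `Literature/Barriers/MatrixMultiplication`; fourth file attached to the catalogue entry
`NilpotentGroupBarrier.lean` (towards the discharge of `BCCGU2017_cor320`,
Blasiak–Church–Cohn–Grochow–Umans 2017, Cor. 3.20). BCCGU bound the slice rank of `𝔽_p[P]`
for a `p`-group `P` through the Jennings basis of the modular group algebra (Prop. 3.10, citing
Jennings 1941: "a basis for `I^k` is given by those monomials `∏ (g_{j,i} - 1)^{m_{j,i}}` with
degree `≥ k`"), whose content is a STRAIGHTENING theorem in `𝔽_p[P]`. This file and its sequel
`NilpotentGroupBarrierPStraighten.lean` prove the form of that theorem we need, for an arbitrary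
central series with elementary abelian factors (the `p`-lower central series of Jennings/BCCGU is
one such series; we do not need its minimality) and the weight `(p+1)^{level}` in place of
Jennings' degree (any weight that strictly increases along `p`-th powers and commutators works).

Source: J. Blasiak, T. Church, H. Cohn, J. A. Grochow, C. Umans, *Which groups are amenable to
proving exponent two for matrix multiplication?*, arXiv:1712.02302
[BlasiakChurchCohnGrochowUmans2017], §3.1.1, Def. 3.4 (augmentation ideal), Def. 3.5 (`p`-lower
central series, `p`-degrees), Prop. 3.10 and its proof sketch ("Set
`x_{j,i} = g_{j,i} - 1 ∈ 𝔽_p[G]`, so every monomial defines an element of `𝔽_p[G]` … the degree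
of a product of such basis elements is the sum of the degrees", held text pp. 6–7); the
underlying algebra is S. A. Jennings, *The structure of the group ring of a `p`-group over a
modular field*, Trans. AMS 50 (1941) (cited through BCCGU).

## Content (all proved)

* `PCGS p S ι` — a **`p`-central generating system** of a group `S`: generators `gen a`
  (`a` in a finite linearly ordered alphabet `ι`) with levels, such that commutators and `p`-th
  powers of generators are ordered products of generators of strictly higher level, every element
  is an ordered product `∏ₐ gen(a)^{e(a)}`, `e(a) < p`, and `|S| = p^{|ι|}` (to be constructed for
  finite `p`-groups of bounded class and exponent in the sequel `NilpotentGroupBarrierPSeries.lean`).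
* Words `w : List ι`, `eval w = ∏ (gen(aᵢ) - 1) ∈ K[S]`, weights `W a = (p+1)^{lvl a}`, `wt`,
  canonical words `canonWord e`; `of_orderedProd` and the expansions `prod_add_one_mem_span`
  (`∏(u_a + 1) - 1 ∈ span{non-empty subwords}`), `span_eval_eq_top` (words span `K[S]`).
* The two rewriting rules: `u_mul_u` (`u_x u_y = u_y u_x + (⁅g_x,g_y⁆ - 1)(u_y u_x + u_y + u_x + 1)`)
  and, in characteristic `p`, `u_pow_p` (`u_x^p = g_x^p - 1`).
* The level filtration `J t m` (span of words with `≥ m` letters of level `≥ t`, a two-sided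
  ideal) and the **nilpotency of long words**: `eval_eq_zero_of_Nstar_le`
  (a word of length `≥ N* = ∏_t ((p-1)·#{letters of level ≥ t} + 1)` vanishes; pigeon-hole, pull
  `p` equal letters of the lowest level to the front modulo higher levels, `u^p` is higher), and
  `eval_eq_zero_of_wt_ge` (weight `≥ N*(p+1)^L` suffices) — the base of the descending induction
  on weight in the straightening theorem of the sequel.
-/

noncomputable section

open scoped BigOperators commutatorElement
open Finset

namespace Literature.Barriers.MatrixMultiplication

universe u v w

/-! ## p-central generating systems -/

section OrderedProd

variable {S : Type u} [Group S] {ι : Type w} [LinearOrder ι] [Fintype ι]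

/-- Ordered product `∏ₐ gen(a)^{e(a)}` (increasing `a` in a finite linearly ordered alphabet) in a
group. [folklore] -/
def orderedProd (gen : ι → S) (e : ι → ℕ) : S :=
  ((Finset.univ.sort (· ≤ ·)).map fun a => gen a ^ e a).prod

/-- The canonical (sorted) word of an exponent vector `e`: each letter `a` repeated `e a` times, in
increasing order. [folklore] -/
def canonWord (e : ι → ℕ) : List ι :=
  (Finset.univ.sort (· ≤ ·)).flatMap fun a => List.replicate (e a) a

/-- Letters of the canonical word. [folklore] -/
theorem mem_canonWord {e : ι → ℕ} {a : ι} : a ∈ canonWord e ↔ e a ≠ 0 := by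
  simp [canonWord, List.mem_flatMap, List.mem_replicate, Finset.mem_sort]

end OrderedProd

section PCGSDef

variable (p : ℕ) (S : Type u) [Group S] (ι : Type w) [LinearOrder ι] [Fintype ι]

/-- **`p`-central generating system** of a finite `p`-group `S` (the data behind the Jennings /
Lazard basis of `𝔽_p[S]`, Blasiak–Church–Cohn–Grochow–Umans 2017, Def. 3.4–3.5 and Prop. 3.10,
here for an arbitrary central series with elementary abelian factors instead of the `p`-lower
central series): generators `gen a` indexed by a finite linearly ordered alphabet `ι`, with
LEVELS `lvl a < L` non-decreasing in `a`, such that (i) every element is an ordered product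
`∏ₐ gen(a)^{e(a)}` with `0 ≤ e(a) < p`, (ii) `|S| = p^{|ι|}` (so these normal forms are unique),
(iii) each commutator `⁅gen a, gen b⁆` is an ordered product of generators of level
`> max(lvl a, lvl b)` and (iv) each `gen(a)^p` is an ordered product of generators of level
`> lvl a`. Such a system comes from any central series
`S = S₀ > S₁ > ⋯ > S_L = 1` with elementary abelian factors (`gen` = lifts of bases of the
factors). [cite: BlasiakChurchCohnGrochowUmans2017, Def. 3.5 and Prop. 3.10] -/
structure PCGS where
  /-- number of levels -/
  L : ℕ
  /-- level of a generator -/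
  lvl : ι → ℕ
  /-- the generators -/
  gen : ι → S
  /-- exponent vector of `⁅gen a, gen b⁆` -/
  commExp : ι → ι → ι → ℕ
  /-- exponent vector of `gen a ^ p` -/
  powExp : ι → ι → ℕ
  lvl_lt : ∀ a, lvl a < L
  lvl_mono : Monotone lvl
  commExp_lt : ∀ a b c, commExp a b c < p
  commExp_lvl : ∀ a b c, commExp a b c ≠ 0 → max (lvl a) (lvl b) < lvl c
  commExp_prod : ∀ a b, ⁅gen a, gen b⁆ = orderedProd gen (commExp a b)
  powExp_lt : ∀ a c, powExp a c < p
  powExp_lvl : ∀ a c, powExp a c ≠ 0 → lvl a < lvl c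
  powExp_prod : ∀ a, gen a ^ p = orderedProd gen (powExp a)
  exists_exp : ∀ g : S, ∃ e : ι → ℕ, (∀ a, e a < p) ∧ g = orderedProd gen e
  card_eq : Nat.card S = p ^ Fintype.card ι

end PCGSDef

namespace PCGS

variable {p : ℕ} {S : Type u} [Group S] {ι : Type w} [LinearOrder ι] [Fintype ι] (C : PCGS p S ι)
variable (K : Type v) [Field K]

/-! ## Words, evaluation, weights, canonical words -/

/-- The letter `u_a = gen(a) - 1 ∈ K[S]` (an element of the augmentation ideal, BCCGU Def. 3.4).
[cite: BlasiakChurchCohnGrochowUmans2017, Def. 3.4 and Prop. 3.10 (proof)] -/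
def u (a : ι) : MonoidAlgebra K S := MonoidAlgebra.of K S (C.gen a) - 1

/-- Evaluation of a word: `eval [a₁,…,a_r] = u_{a₁} ⋯ u_{a_r}`. [cite: BlasiakChurchCohnGrochowUmans2017, Prop. 3.10 (proof)] -/
def eval (w : List ι) : MonoidAlgebra K S := (w.map (C.u K)).prod

variable {K}

/-- The weight of a letter: `(p+1)^{lvl a}` (powers and commutators strictly raise the weight).
[folklore] -/
def W (a : ι) : ℕ := (p + 1) ^ C.lvl a

/-- The weight of a word. [folklore] -/
def wt (w : List ι) : ℕ := (w.map C.W).sum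

/-- Number of letters of level `≥ t` in a word. [folklore] -/
def countLev (t : ℕ) (w : List ι) : ℕ := w.countP fun a => t ≤ C.lvl a

/-- `eval [] = 1`. [folklore] -/
@[simp] theorem eval_nil : C.eval K [] = 1 := by simp [eval]

/-- `eval (a :: w) = u_a · eval w`. [folklore] -/
@[simp] theorem eval_cons (a : ι) (w : List ι) :
    C.eval K (a :: w) = C.u K a * C.eval K w := by simp [eval]

/-- `eval (w₁ ++ w₂) = eval w₁ · eval w₂`. [folklore] -/
theorem eval_append (w₁ w₂ : List ι) :
    C.eval K (w₁ ++ w₂) = C.eval K w₁ * C.eval K w₂ := by simp [eval]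

/-- `eval [a] = u_a`. [folklore] -/
theorem eval_singleton (a : ι) : C.eval K [a] = C.u K a := by simp [eval]

/-- `wt [] = 0`. [folklore] -/
@[simp] theorem wt_nil : C.wt [] = 0 := by simp [wt]

/-- `wt (a :: w) = W a + wt w`. [folklore] -/
@[simp] theorem wt_cons (a : ι) (w : List ι) : C.wt (a :: w) = C.W a + C.wt w := by
  simp [wt]

/-- `wt (w₁ ++ w₂) = wt w₁ + wt w₂`. [folklore] -/
theorem wt_append (w₁ w₂ : List ι) : C.wt (w₁ ++ w₂) = C.wt w₁ + C.wt w₂ := by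
  simp [wt]

/-- `countLev t [] = 0`. [folklore] -/
@[simp] theorem countLev_nil (t : ℕ) : C.countLev t [] = 0 := by simp [countLev]

/-- `countLev` of a cons. [folklore] -/
theorem countLev_cons (t : ℕ) (a : ι) (w : List ι) :
    C.countLev t (a :: w) = C.countLev t w + if t ≤ C.lvl a then 1 else 0 := by
  simp [countLev, List.countP_cons]

/-- `countLev` is additive. [folklore] -/
theorem countLev_append (t : ℕ) (w₁ w₂ : List ι) :
    C.countLev t (w₁ ++ w₂) = C.countLev t w₁ + C.countLev t w₂ := by
  simp [countLev, List.countP_append]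

/-- `countLev` is antitone in the level. [folklore] -/
theorem countLev_mono {t t' : ℕ} (h : t ≤ t') (w : List ι) :
    C.countLev t' w ≤ C.countLev t w :=
  List.countP_mono_left fun a _ ha => by
    simp only [decide_eq_true_eq] at ha ⊢; exact h.trans ha

/-- `of(∏ gen(a)^{e a}) = ∏ (u_a + 1)` along the canonical word. [folklore] -/
theorem of_orderedProd (e : ι → ℕ) :
    MonoidAlgebra.of K S (orderedProd C.gen e) = ((canonWord e).map fun a => C.u K a + 1).prod := by
  rw [orderedProd, map_list_prod, List.map_map, canonWord, List.map_flatMap, List.flatMap_def,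
    List.prod_flatten, List.map_map]
  congr 1
  refine List.map_congr_left fun a _ => ?_
  simp [u, List.map_replicate, List.prod_replicate]

/-! ## Expansion of group elements along words -/

/-- `∏_{a ∈ l} (u_a + 1) ∈ span {eval l' : l' a sublist of l}` and
`∏_{a ∈ l} (u_a + 1) - 1 ∈ span {eval l' : l' a non-empty sublist of l}` (telescoping).
[folklore] -/
theorem prod_add_one_mem_span (l : List ι) :
    (l.map fun a => C.u K a + 1).prod ∈
        Submodule.span K (C.eval K '' {l' | l'.Sublist l}) ∧
      (l.map fun a => C.u K a + 1).prod - 1 ∈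
        Submodule.span K (C.eval K '' {l' | l'.Sublist l ∧ l' ≠ []}) := by
  induction l with
  | nil =>
    refine ⟨?_, by simp⟩
    simp only [List.map_nil, List.prod_nil]
    exact Submodule.subset_span ⟨[], by simp, by simp⟩
  | cons a l ih =>
    obtain ⟨ih1, ih2⟩ := ih
    set X := (l.map fun a => C.u K a + 1).prod with hX
    have hstep : ((a :: l).map fun a => C.u K a + 1).prod = C.u K a * X + X := by
      simp [hX, add_mul]
    -- `u_a * X` lies in the span of the non-empty sublists of `a :: l`
    have hmul : C.u K a * X ∈ Submodule.span K (C.eval K '' {l' | l'.Sublist (a :: l) ∧ l' ≠ []}) := by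
      have h1 : C.u K a * X ∈ (Submodule.span K (C.eval K '' {l' | l'.Sublist l})).map
          (LinearMap.mulLeft K (C.u K a)) := Submodule.mem_map_of_mem ih1
      rw [Submodule.map_span] at h1
      refine Submodule.span_mono ?_ h1
      rintro _ ⟨_, ⟨l', hl', rfl⟩, rfl⟩
      refine ⟨a :: l', ⟨?_, List.cons_ne_nil _ _⟩, ?_⟩
      · exact hl'.cons_cons a
      · simp [LinearMap.mulLeft_apply]
    have hsub : Submodule.span K (C.eval K '' {l' | l'.Sublist l ∧ l' ≠ []}) ≤
        Submodule.span K (C.eval K '' {l' | l'.Sublist (a :: l) ∧ l' ≠ []}) :=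
      Submodule.span_mono (Set.image_mono fun l' hl' => ⟨hl'.1.cons a, hl'.2⟩)
    have hsub' : Submodule.span K (C.eval K '' {l' | l'.Sublist (a :: l) ∧ l' ≠ []}) ≤
        Submodule.span K (C.eval K '' {l' | l'.Sublist (a :: l)}) :=
      Submodule.span_mono (Set.image_mono fun l' hl' => hl'.1)
    have h2 : ((a :: l).map fun a => C.u K a + 1).prod - 1 ∈
        Submodule.span K (C.eval K '' {l' | l'.Sublist (a :: l) ∧ l' ≠ []}) := by
      rw [hstep, add_sub_assoc]
      exact Submodule.add_mem _ hmul (hsub ih2)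
    refine ⟨?_, h2⟩
    have : ((a :: l).map fun a => C.u K a + 1).prod =
        (((a :: l).map fun a => C.u K a + 1).prod - 1) + 1 := by abel
    rw [this]
    refine Submodule.add_mem _ (hsub' h2) (Submodule.subset_span ⟨[], by simp, by simp⟩)

/-- Every group element lies in the span of the words: `of g ∈ span (eval '' univ)`. [folklore] -/
theorem of_mem_span_eval (g : S) :
    MonoidAlgebra.of K S g ∈ Submodule.span K (Set.range (C.eval K)) := by
  obtain ⟨e, -, rfl⟩ := C.exists_exp g
  rw [C.of_orderedProd]
  refine Submodule.span_mono ?_ (C.prod_add_one_mem_span (canonWord e)).1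
  rintro _ ⟨l', -, rfl⟩
  exact ⟨l', rfl⟩

/-- The words span `K[S]`. [folklore] -/
theorem span_eval_eq_top : Submodule.span K (Set.range (C.eval K)) = ⊤ := by
  refine Submodule.eq_top_iff'.2 fun f => ?_
  induction f using MonoidAlgebra.induction_on with
  | hM g => exact C.of_mem_span_eval g
  | hadd f g hf hg => exact Submodule.add_mem _ hf hg
  | hsmul r f hf => exact Submodule.smul_mem _ r hf

/-! ## The two rewriting identities -/

/-- **Commutation rule**: `u_x u_y = u_y u_x + (⁅gen x, gen y⁆ - 1)(u_y u_x + u_y + u_x + 1)`.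
[cite: BlasiakChurchCohnGrochowUmans2017, Prop. 3.10 (proof)] -/
theorem u_mul_u (x y : ι) :
    C.u K x * C.u K y = C.u K y * C.u K x +
      (MonoidAlgebra.of K S ⁅C.gen x, C.gen y⁆ - 1) * (C.u K y * C.u K x + C.u K y + C.u K x + 1) := by
  have hc : MonoidAlgebra.of K S ⁅C.gen x, C.gen y⁆ *
      (MonoidAlgebra.of K S (C.gen y) * MonoidAlgebra.of K S (C.gen x)) =
      MonoidAlgebra.of K S (C.gen x) * MonoidAlgebra.of K S (C.gen y) := by
    rw [← map_mul, ← map_mul, ← map_mul]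
    congr 1
    rw [commutatorElement_def]
    group
  have key : C.u K y * C.u K x + C.u K y + C.u K x + 1 =
      MonoidAlgebra.of K S (C.gen y) * MonoidAlgebra.of K S (C.gen x) := by
    simp only [u]; noncomm_ring
  rw [key, sub_mul, hc, one_mul]
  simp only [u]
  noncomm_ring

section CharP

variable [Fact p.Prime] [CharP K p]

omit [Fact p.Prime] in
/-- `K[S]` has the characteristic of `K`. [folklore] -/
theorem charP_monoidAlgebra : CharP (MonoidAlgebra K S) p := by
  have h : Function.Injective (algebraMap K (MonoidAlgebra K S)) := by
    rw [MonoidAlgebra.coe_algebraMap]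
    exact MonoidAlgebra.single_right_injective.comp (algebraMap K K).injective
  exact charP_of_injective_algebraMap h p

/-- **Power rule** (characteristic `p`): `u_x^p = gen(x)^p - 1`. [cite: BlasiakChurchCohnGrochowUmans2017, Prop. 3.10 (proof)] -/
theorem u_pow_p (x : ι) :
    C.u K x ^ p = MonoidAlgebra.of K S (C.gen x ^ p) - 1 := by
  haveI := charP_monoidAlgebra (p := p) (S := S) (K := K)
  rw [u, sub_pow_char_of_commute p (Commute.one_right _), one_pow, map_pow]

end CharP

/-! ## The level filtration and nilpotency of long words -/

variable (K) in
/-- `𝒥 t m` = span of the words with at least `m` letters of level `≥ t` (a two-sided ideal).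
[cite: BlasiakChurchCohnGrochowUmans2017, Prop. 3.10 (proof)] -/
def J (t m : ℕ) : Submodule K (MonoidAlgebra K S) :=
  Submodule.span K (C.eval K '' {w | m ≤ C.countLev t w})

/-- Words with enough high letters lie in `𝒥`. [folklore] -/
theorem eval_mem_J {t m : ℕ} {w : List ι} (h : m ≤ C.countLev t w) : C.eval K w ∈ C.J K t m :=
  Submodule.subset_span ⟨w, h, rfl⟩

/-- `𝒥` is antitone in the level. [folklore] -/
theorem J_anti_left {t t' : ℕ} (h : t ≤ t') (m : ℕ) : C.J K t' m ≤ C.J K t m :=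
  Submodule.span_mono (Set.image_mono fun w hw => le_trans hw (C.countLev_mono h w))

/-- `𝒥` is antitone in the count. [folklore] -/
theorem J_anti_right (t : ℕ) {m m' : ℕ} (h : m ≤ m') : C.J K t m' ≤ C.J K t m :=
  Submodule.span_mono (Set.image_mono fun _ hw => le_trans h hw)

/-- `𝒥 t 0 = K[S]`. [folklore] -/
theorem J_zero_right (t : ℕ) : C.J K t 0 = ⊤ := by
  refine eq_top_iff.2 ?_
  rw [← C.span_eval_eq_top (K := K)]
  refine Submodule.span_mono ?_
  rintro _ ⟨w, rfl⟩
  exact ⟨w, Nat.zero_le _, rfl⟩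

/-- `𝒥 t a · 𝒥 t b ⊆ 𝒥 t (a+b)`. [folklore] -/
theorem J_mul_J_le (t a b : ℕ) : C.J K t a * C.J K t b ≤ C.J K t (a + b) := by
  rw [J, J, Submodule.span_mul_span]
  refine Submodule.span_le.2 ?_
  rintro _ ⟨_, ⟨w₁, hw₁, rfl⟩, _, ⟨w₂, hw₂, rfl⟩, rfl⟩
  refine Submodule.subset_span ⟨w₁ ++ w₂, ?_, (C.eval_append w₁ w₂)⟩
  simp only [Set.mem_setOf_eq, countLev_append] at hw₁ hw₂ ⊢
  omega

/-- Two-sided ideal property on words: `eval w₁ · x · eval w₂ ∈ 𝒥 t m` for `x ∈ 𝒥 t m`. [folklore] -/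
theorem eval_mul_mem_J_mul_eval {t m : ℕ} {x : MonoidAlgebra K S} (hx : x ∈ C.J K t m)
    (w₁ w₂ : List ι) : C.eval K w₁ * x * C.eval K w₂ ∈ C.J K t m := by
  induction hx using Submodule.span_induction with
  | mem y hy =>
    obtain ⟨w, hw, rfl⟩ := hy
    rw [← eval_append, ← eval_append]
    refine C.eval_mem_J ?_
    simp only [Set.mem_setOf_eq, countLev_append] at hw ⊢
    omega
  | zero => simp
  | add y z _ _ hy hz => rw [mul_add, add_mul]; exact Submodule.add_mem _ hy hz
  | smul r y _ hy => rw [mul_smul_comm, smul_mul_assoc]; exact Submodule.smul_mem _ r hy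

/-- Elements of the span of all words multiply `𝒥 t m` into itself (both sides). [folklore] -/
theorem span_mul_mem_J {t m : ℕ} {x y : MonoidAlgebra K S} (hx : x ∈ C.J K t m)
    (hy : y ∈ Submodule.span K (Set.range (C.eval K))) :
    y * x ∈ C.J K t m ∧ x * y ∈ C.J K t m := by
  induction hy using Submodule.span_induction with
  | mem z hz =>
    obtain ⟨w, rfl⟩ := hz
    constructor
    · simpa using C.eval_mul_mem_J_mul_eval hx w []
    · simpa using C.eval_mul_mem_J_mul_eval hx [] w
  | zero => simp
  | add z z' _ _ hz hz' =>
    rw [add_mul, mul_add]; exact ⟨Submodule.add_mem _ hz.1 hz'.1, Submodule.add_mem _ hz.2 hz'.2⟩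
  | smul r z _ hz =>
    rw [smul_mul_assoc, mul_smul_comm]; exact ⟨Submodule.smul_mem _ r hz.1, Submodule.smul_mem _ r hz.2⟩

/-- Any element multiplies `𝒥 t m` into itself (the words span `K[S]`). [folklore] -/
theorem mul_mem_J {t m : ℕ} {x : MonoidAlgebra K S} (hx : x ∈ C.J K t m) (y : MonoidAlgebra K S) :
    y * x ∈ C.J K t m ∧ x * y ∈ C.J K t m :=
  C.span_mul_mem_J hx (by rw [C.span_eval_eq_top]; trivial)

/-- A product `∏(u_a + 1) - 1` over a canonical word all of whose letters have level `> t` lies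
in `𝒥 (t+1) 1`. [folklore] -/
theorem prod_add_one_sub_one_mem_J {e : ι → ℕ} {t : ℕ} (he : ∀ c, e c ≠ 0 → t < C.lvl c) :
    ((canonWord e).map fun a => C.u K a + 1).prod - 1 ∈ C.J K (t + 1) 1 := by
  refine Submodule.span_mono ?_ (C.prod_add_one_mem_span (canonWord e)).2
  rintro _ ⟨l', ⟨hl', hne⟩, rfl⟩
  refine ⟨l', ?_, rfl⟩
  obtain ⟨a, ha⟩ := List.exists_mem_of_ne_nil l' hne
  have ha' : t + 1 ≤ C.lvl a := he a (mem_canonWord.1 (hl'.subset ha))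
  simp only [Set.mem_setOf_eq, countLev]
  exact List.countP_pos_iff.2 ⟨a, ha, by simpa using ha'⟩

/-- **Commutators are higher**: `u_x u_y - u_y u_x ∈ 𝒥 (max(lvl x, lvl y) + 1) 1`.
[cite: BlasiakChurchCohnGrochowUmans2017, Prop. 3.10 (proof)] -/
theorem u_mul_u_sub_mem_J (x y : ι) :
    C.u K x * C.u K y - C.u K y * C.u K x ∈ C.J K (max (C.lvl x) (C.lvl y) + 1) 1 := by
  rw [C.u_mul_u, add_sub_cancel_left, C.commExp_prod, C.of_orderedProd]
  exact (C.mul_mem_J (C.prod_add_one_sub_one_mem_J (C.commExp_lvl x y)) _).2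

/-- **Pulling a letter to the front** modulo higher levels: for a letter `x` of level `≥ t`
occurring in `w`, `eval w ≡ u_x · eval (w.erase x)` modulo `𝒥 (t+1) 1`. [folklore] -/
theorem eval_sub_u_mul_eval_erase_mem_J {t : ℕ} {x : ι} (hx : t ≤ C.lvl x) :
    ∀ {w : List ι}, x ∈ w → C.eval K w - C.u K x * C.eval K (w.erase x) ∈ C.J K (t + 1) 1 := by
  intro w
  induction w with
  | nil => intro h; simp at h
  | cons a w ih =>
    intro hmem
    by_cases hax : a = x
    · subst hax
      simp
    · have hxw : x ∈ w := by simpa [Ne.symm hax] using hmem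
      rw [List.erase_cons_tail (by simpa using hax), eval_cons, eval_cons]
      have hsplit : C.u K a * C.eval K w - C.u K x * (C.u K a * C.eval K (w.erase x)) =
          C.u K a * (C.eval K w - C.u K x * C.eval K (w.erase x)) -
            (C.u K x * C.u K a - C.u K a * C.u K x) * C.eval K (w.erase x) := by noncomm_ring
      rw [hsplit]
      refine Submodule.sub_mem _ (C.mul_mem_J (ih hxw) _).1 ?_
      refine (C.mul_mem_J ?_ _).2
      exact C.J_anti_left (by omega) 1 (C.u_mul_u_sub_mem_J x a)

/-- Pulling `k` copies of a letter to the front. [folklore] -/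
theorem eval_sub_u_pow_mul_eval_diff_mem_J {t : ℕ} {x : ι} (hx : t ≤ C.lvl x) (k : ℕ) :
    ∀ {w : List ι}, k ≤ w.count x →
      C.eval K w - C.u K x ^ k * C.eval K (w.diff (List.replicate k x)) ∈ C.J K (t + 1) 1 := by
  induction k with
  | zero => intro w _; simp
  | succ k ih =>
    intro w hk
    have hxw : x ∈ w := List.count_pos_iff.1 (by omega)
    have h1 := C.eval_sub_u_mul_eval_erase_mem_J (K := K) hx hxw
    have hk' : k ≤ (w.erase x).count x := by rw [List.count_erase_self]; omega
    have h2 := ih hk'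
    rw [List.replicate_succ, List.diff_cons]
    have hsplit : C.eval K w - C.u K x ^ (k + 1) * C.eval K ((w.erase x).diff (List.replicate k x)) =
        (C.eval K w - C.u K x * C.eval K (w.erase x)) +
          C.u K x * (C.eval K (w.erase x) -
            C.u K x ^ k * C.eval K ((w.erase x).diff (List.replicate k x))) := by
      rw [pow_succ']; noncomm_ring
    rw [hsplit]
    exact Submodule.add_mem _ h1 (C.mul_mem_J h2 _).1

section CharP

variable [Fact p.Prime] [CharP K p]

/-- `u_x^p ∈ 𝒥 (lvl x + 1) 1` (the `p`-th power of a generator is higher).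
[cite: BlasiakChurchCohnGrochowUmans2017, Prop. 3.10 (proof)] -/
theorem u_pow_p_mem_J (x : ι) : C.u K x ^ p ∈ C.J K (C.lvl x + 1) 1 := by
  rw [C.u_pow_p, C.powExp_prod, C.of_orderedProd]
  exact C.prod_add_one_sub_one_mem_J (C.powExp_lvl x)

omit [Fact p.Prime] [CharP K p] in
/-- Counting letters of level `≥ t` by generator. [folklore] -/
theorem sum_count_eq_countLev (t : ℕ) (w : List ι) :
    ∑ a ∈ Finset.univ.filter (fun a => t ≤ C.lvl a), w.count a = C.countLev t w := by
  induction w with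
  | nil => simp
  | cons b w ih =>
    simp only [List.count_cons, Finset.sum_add_distrib, ih, countLev_cons, beq_iff_eq]
    congr 1
    rw [Finset.sum_ite_eq]
    simp

/-- The pigeon-hole threshold `N_t = (p-1)·#{a : lvl a ≥ t} + 1`. [folklore] -/
def Nlev (t : ℕ) : ℕ := (p - 1) * (Finset.univ.filter fun a : ι => t ≤ C.lvl a).card + 1

/-- **One step up**: a word with `≥ N_t` letters of level `≥ t` lies in `𝒥 (t+1) 1` (some
generator of level `≥ t` occurs `p` times; pull `p` copies to the front and use `u^p ∈ 𝒥`).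
[cite: BlasiakChurchCohnGrochowUmans2017, Prop. 3.10 (proof)] -/
theorem eval_mem_J_succ_of_Nlev_le {t : ℕ} {w : List ι} (hw : C.Nlev t ≤ C.countLev t w) :
    C.eval K w ∈ C.J K (t + 1) 1 := by
  -- pigeon-hole: some letter of level `≥ t` occurs at least `p` times
  obtain ⟨x, hx, hpx⟩ : ∃ x, t ≤ C.lvl x ∧ p ≤ w.count x := by
    by_contra hcon
    push Not at hcon
    have hle : C.countLev t w ≤ (p - 1) * (Finset.univ.filter fun a : ι => t ≤ C.lvl a).card := by
      rw [← C.sum_count_eq_countLev, mul_comm]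
      refine (Finset.sum_le_card_nsmul _ _ (p - 1) fun a ha => ?_).trans (by simp)
      have := hcon a (Finset.mem_filter.1 ha).2
      omega
    unfold Nlev at hw
    omega
  have h1 := C.eval_sub_u_pow_mul_eval_diff_mem_J (K := K) hx p hpx
  have h2 : C.u K x ^ p * C.eval K (w.diff (List.replicate p x)) ∈ C.J K (t + 1) 1 :=
    (C.mul_mem_J (C.J_anti_left (by omega) 1 (C.u_pow_p_mem_J x)) _).2
  simpa using Submodule.add_mem _ h1 h2

omit [Fact p.Prime] [CharP K p] in
/-- Splitting off a prefix with a prescribed number of letters of level `≥ t`. [folklore] -/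
theorem exists_split_countLev (t : ℕ) :
    ∀ (w : List ι) {m : ℕ}, m ≤ C.countLev t w →
      ∃ w₁ w₂, w = w₁ ++ w₂ ∧ C.countLev t w₁ = m := by
  intro w
  induction w with
  | nil =>
    intro m hm
    refine ⟨[], [], rfl, ?_⟩
    simp only [countLev_nil, nonpos_iff_eq_zero] at hm ⊢
    exact hm.symm
  | cons a w ih =>
    intro m hm
    rcases Nat.eq_zero_or_pos m with rfl | hmpos
    · exact ⟨[], a :: w, rfl, by simp⟩
    rw [countLev_cons] at hm
    by_cases ha : t ≤ C.lvl a
    · rw [if_pos ha] at hm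
      obtain ⟨w₁, w₂, rfl, hw₁⟩ := ih (m := m - 1) (by omega)
      refine ⟨a :: w₁, w₂, rfl, ?_⟩
      rw [countLev_cons, if_pos ha, hw₁]; omega
    · rw [if_neg ha] at hm
      obtain ⟨w₁, w₂, rfl, hw₁⟩ := ih (m := m) (by omega)
      refine ⟨a :: w₁, w₂, rfl, ?_⟩
      rw [countLev_cons, if_neg ha, hw₁]; omega

/-- **Amplification**: `k·N_t` letters of level `≥ t` put the word in `𝒥 (t+1) k`.
[cite: BlasiakChurchCohnGrochowUmans2017, Prop. 3.10 (proof)] -/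
theorem eval_mem_J_succ (t : ℕ) : ∀ (k : ℕ) {w : List ι},
    k * C.Nlev t ≤ C.countLev t w → C.eval K w ∈ C.J K (t + 1) k := by
  intro k
  induction k with
  | zero => intro w _; rw [C.J_zero_right]; trivial
  | succ k ih =>
    intro w hw
    rw [Nat.succ_mul] at hw
    have hN : C.Nlev t ≤ C.countLev t w := le_trans (Nat.le_add_left _ _) hw
    obtain ⟨w₁, w₂, rfl, hw₁⟩ := C.exists_split_countLev t w hN
    rw [countLev_append, hw₁] at hw
    have h2 : C.eval K w₂ ∈ C.J K (t + 1) k := ih (by omega)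
    have h1 : C.eval K w₁ ∈ C.J K (t + 1) 1 := C.eval_mem_J_succ_of_Nlev_le hw₁.ge
    rw [eval_append]
    have h := C.J_mul_J_le (t + 1) 1 k (Submodule.mul_mem_mul h1 h2)
    rw [Nat.add_comm 1 k] at h
    exact h

/-- The filtration step: `𝒥 t (k·N_t) ≤ 𝒥 (t+1) k`. [cite: BlasiakChurchCohnGrochowUmans2017, Prop. 3.10 (proof)] -/
theorem J_le_J_succ (t k : ℕ) : C.J K t (k * C.Nlev t) ≤ C.J K (t + 1) k := by
  refine Submodule.span_le.2 ?_
  rintro _ ⟨w, hw, rfl⟩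
  exact C.eval_mem_J_succ t k hw

omit [Fact p.Prime] [CharP K p] in
/-- Above the top level the filtration is trivial: `𝒥 L 1 = 0`. [folklore] -/
theorem J_L_one : C.J K C.L 1 = ⊥ := by
  rw [J, Submodule.span_eq_bot]
  rintro _ ⟨w, hw, rfl⟩
  exfalso
  have h0 : C.countLev C.L w = 0 := by
    rw [countLev, List.countP_eq_zero]
    intro a _
    simpa using C.lvl_lt a
  simp only [Set.mem_setOf_eq, h0] at hw
  exact Nat.not_succ_le_zero 0 hw

/-- The nilpotency length `N* = ∏_{t<L} N_t`. [folklore] -/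
def Nstar : ℕ := ∏ t ∈ Finset.range C.L, C.Nlev t

/-- **Nilpotency of long words** (the augmentation ideal of `𝔽_p[S]` is nilpotent): a word of
length `≥ N*` evaluates to `0`. [cite: BlasiakChurchCohnGrochowUmans2017, §3.1.1] -/
theorem eval_eq_zero_of_Nstar_le {w : List ι} (hw : C.Nstar ≤ w.length) :
    C.eval K w = 0 := by
  -- `eval w ∈ 𝒥 t (∏_{t ≤ t' < L} N_{t'})` for all `t ≤ L`
  have key : ∀ t, t ≤ C.L → C.eval K w ∈ C.J K t (∏ t' ∈ Finset.Ico t C.L, C.Nlev t') := by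
    intro t
    induction t with
    | zero =>
      intro _
      refine C.eval_mem_J ?_
      rw [Nat.Ico_zero_eq_range]
      refine le_trans hw ?_
      simp [countLev]
    | succ t ih =>
      intro ht
      have h := ih (by omega)
      rw [Finset.prod_eq_prod_Ico_succ_bot (by omega : t < C.L), mul_comm] at h
      exact C.J_le_J_succ t _ h
  have h := key C.L le_rfl
  rw [Finset.Ico_self, Finset.prod_empty, C.J_L_one, Submodule.mem_bot] at h
  exact h

omit [Fact p.Prime] [CharP K p] in
/-- `wt w ≤ |w| (p+1)^L`. [folklore] -/
theorem wt_le_length_mul (w : List ι) : C.wt w ≤ w.length * (p + 1) ^ C.L := by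
  induction w with
  | nil => simp
  | cons a w ih =>
    rw [wt_cons, List.length_cons, Nat.succ_mul]
    have : C.W a ≤ (p + 1) ^ C.L := Nat.pow_le_pow_right (Nat.succ_pos p) (C.lvl_lt a).le
    omega

/-- Hence words of weight `≥ N*·(p+1)^L` vanish (each letter weighs `≤ (p+1)^{L-1} < (p+1)^L`).
[folklore] -/
theorem eval_eq_zero_of_wt_ge {w : List ι} (hw : C.Nstar * (p + 1) ^ C.L ≤ C.wt w) :
    C.eval K w = 0 := by
  refine C.eval_eq_zero_of_Nstar_le ?_
  have hpos : 0 < (p + 1) ^ C.L := Nat.pow_pos (Nat.succ_pos p)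
  exact Nat.le_of_mul_le_mul_right (hw.trans (C.wt_le_length_mul w)) hpos

end CharP

end PCGS

end Literature.Barriers.MatrixMultiplication

end
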